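import Summits.FinalStateConjecture.FinalStateConjecture.Theses.PhotonSphereChannels
import Summits.FinalStateConjecture.FinalStateConjecture.Theorems.PhotonSphereChannelsEndVisibleDefs

/-!
# Re-keying menu for crux stmt-FinalStateConjecture-17430 (planner-facing; lead prover-line-stmt-FinalStateConjecture-17430-0)

Option (α) of the line report: re-key the crux as `K2REndItem` (the crux with clause (C) weakened to
C_end, stated over the LANDED vocabulary `Theorems.EndVisible.SettlesEndVisibly` / `Theorems.TrappedSet.*`)
and file `NoHiddenItem` (operator-contingent causal topology) separately; the two `example`s check that
(both items ⇒ the current crux verbatim) and (the crux ⇒ K2REndItem), so `closes` needs one extra line.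
Written in the route file's namespace so the signatures can be pasted into `ledger workitem add … --signature`.
lean check rc 0 (2026-08-17).
-/

set_option linter.dupNamespace false

namespace Summit.FinalStateConjecture.FinalStateConjecture.Theses.PhotonSphereChannels

/-- (α) re-keyed K2REnd item signature, as it would read inside the route file -/
def K2REndItem : Prop :=
  UniformPhotonSphereChannelsR → ∀ (X : Type) [TopologicalSpace X] [ChartedSpace Literature.Geometry.Lorentzian.E3 X] [IsManifold (modelWithCornersSelf ℝ Literature.Geometry.Lorentzian.E3) ((⊤ : ℕ∞) : WithTop ℕ∞) X] [T2Space X] [SecondCountableTopology X] [ConnectedSpace X], ∀ D ∈ Literature.Geometry.Lorentzian.admissibleVacuumData X, ∀ 𝒟 : Literature.Geometry.Lorentzian.VacuumCauchyDevelopment D, 𝒟.IsMaximal → _root_.Summit.FinalStateConjecture.HasCompleteNullInfinity 𝒟.toCauchyDevelopment → (_root_.Summit.FinalStateConjecture.FinalStateConjecture.Theorems.TrappedSet.NoExtremalRemnant 𝒟 ∧ _root_.Summit.FinalStateConjecture.FinalStateConjecture.Theorems.TrappedSet.TameOuterRegion 𝒟) → _root_.Summit.FinalStateConjecture.FinalStateConjecture.Theorems.EndVisible.SettlesEndVisibly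 𝒟

/-- NoHidden item signature -/
def NoHiddenItem : Prop :=
  ∀ (X : Type) [TopologicalSpace X] [ChartedSpace Literature.Geometry.Lorentzian.E3 X] [IsManifold (modelWithCornersSelf ℝ Literature.Geometry.Lorentzian.E3) ((⊤ : ℕ∞) : WithTop ℕ∞) X] [T2Space X] [SecondCountableTopology X] [ConnectedSpace X], ∀ D ∈ Literature.Geometry.Lorentzian.admissibleVacuumData X, ∀ 𝒟 : Literature.Geometry.Lorentzian.VacuumCauchyDevelopment D, 𝒟.IsMaximal → _root_.Summit.FinalStateConjecture.HasCompleteNullInfinity 𝒟.toCauchyDevelopment → (_root_.Summit.FinalStateConjecture.FinalStateConjecture.Theorems.TrappedSet.NoExtremalRemnant 𝒟 ∧ _root_.Summit.FinalStateConjecture.FinalStateConjecture.Theorems.TrappedSet.TameOuterRegion 𝒟) → _root_.Summit.FinalStateConjecture.FinalStateConjecture.Theorems.EndVisible.CompleteRaysNearEndVisible 𝒟.toCauchyDevelopment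

/-- the glue `closes` would use: both items ⇒ the current crux verbatim -/
example (hA : NoHiddenItem) (hB : K2REndItem) : ChannelsResolveTameDevelopmentsR := by
  intro h₁ X _ _ _ _ _ _ D hD 𝒟 hmax hcomp hyp
  exact _root_.Summit.FinalStateConjecture.FinalStateConjecture.Theorems.EndVisible.settlesT2_of_settlesEndVisibly
    (hB h₁ X D hD 𝒟 hmax hcomp hyp) (hA X D hD 𝒟 hmax hcomp hyp)

/-- and the crux ⇒ the K2REnd item -/
example (h : ChannelsResolveTameDevelopmentsR) : K2REndItem := by
  intro h₁ X _ _ _ _ _ _ D hD 𝒟 hmax hcomp hyp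
  exact _root_.Summit.FinalStateConjecture.FinalStateConjecture.Theorems.EndVisible.settlesEndVisibly_of_settlesT2
    (h h₁ X D hD 𝒟 hmax hcomp hyp)

end Summit.FinalStateConjecture.FinalStateConjecture.Theses.PhotonSphereChannels
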